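import Literature.NumberTheory.Automorphic.UnitaryGroupSymplecticEmbedding
import Literature.LinearAlgebra.SymmetricMatrixPrescribedValues
import HarnessLib

/-!
# An isotropic line of a hermitian space over a quadratic algebra, in the `R`-rational polarisation: real part of the
# hermitian pairing, a line in general position, and the Lagrangian graph containing it

Topic `NumberTheory/Automorphic`; namespace `Literature.NumberTheory.Automorphic.UnitaryGroup` (continuing
`QuadraticRestrictionOfScalars`, `UnitaryGroupSymplecticEmbedding`).  KERNEL ONLY: theorems, no definition, no named
fact, no `sorry`.

Setting: quadratic coordinates `h : IsQuadraticCoordinates φ Ψ δ d` (`S = φ(R) ⊕ φ(R) δ`, `δ² = φ d`), a conjugation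
`σ` (`σ ∘ φ = φ`, `σ δ = -δ`) and an `R`-rational symmetric Gram matrix `T`, hermitian pairing
`h(x, y) = (σ x)ᵀ (T ⊗ 1) y` on `Sⁿ` (`hermForm`), polarisation `reIm : Sⁿ ≃ Rⁿ × Rⁿ`, `β_T = Matrix.toLinearMap₂' R T`.
The tree already has `im h(x, y) = alt (polar β_T) (reIm x) (reIm y)` (`im_hermForm_map`).  Here:

* §1 `re_hermForm_map`: **`re h(x, y) = β_T(a, a') - d β_T(b, b')`** (`x = a + bδ`, `y = a' + b'δ`); the coordinates of a
  scalar multiple, `reIm (e • x) = (re e · a + d im e · b, im e · a + re e · b)` (`fst_reIm_smul`, `snd_reIm_smul`);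
  sesquilinearity `h(e x, e' y) = σ(e) e' h(x, y)` (`hermForm_smul_smul`).
* §2 **an isotropic vector in general position** (`exists_isotropic_linearIndependent`): over a FIELD `R` with `2`
  invertible, `det T` a unit and `d` NOT A SQUARE in `R` (i.e. `S` a field), if `(Sⁿ, h)` has a non-zero isotropic vector
  then it has an isotropic vector `x = a + bδ` whose real and imaginary parts `a, b ∈ Rⁿ` are linearly independent — a
  real isotropic `a₀` (`β_T(a₀,a₀) = 0`) being replaced by `a₀ + c δ` for a hyperbolic partner `c` of `a₀`
  ([Serre1973, Ch. IV §1.3 Prop. 3]; this is the isotropic line `X'` of [MoeglinVignerasWaldspurger1987, Chap. 3 §IV.2]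
  chosen transversally to both Lagrangians `Rⁿ · 1`, `Rⁿ · δ`).
* §3 **the Lagrangian graph through the line** (`exists_isSymm_graph_and_dual`): for such `x` there are a symmetric
  `S_x ∈ Mₙ(R)` with `T · im(e x) = S_x · re(e x)` for EVERY scalar `e ∈ S` (the `R`-plane `reIm (S · x)` lies in the
  Lagrangian `{(u, w) : T w = S_x u}` of `alt (polar β_T)`), and a vector `a'` with `a' · re(e x) = re e` for all `e`.

Consumer: `RepresentationTheory/MoeglinVignerasWaldspurger1987/RankOneThetaLiftNonvanishingProofs.lean`.

## References
* [MoeglinVignerasWaldspurger1987] C. Mœglin, M.-F. Vignéras, J.-L. Waldspurger, LNM 1291 (1987), Chap. 1 I.17 (the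
  symplectic space `Res V ⊗ W`), Chap. 3 §IV.2 (the isotropic line `X'`).
* [Serre1973] J.-P. Serre, *A Course in Arithmetic*, GTM 7, Ch. IV §1.3 Prop. 3 (hyperbolic planes).
* [GelbartRogawski1991] S. Gelbart, J. Rogawski, Invent. Math. 105 (1991), §3.1 p. 454 (`W = Res_{E/F} V`).
-/

set_option autoImplicit false

namespace Literature.NumberTheory.Automorphic

namespace UnitaryGroup

namespace IsQuadraticCoordinates

open _root_.Matrix QuadraticCoordinates Literature.RepresentationTheory.HeisenbergGroup

section CommRing

variable {R S : Type*} [CommRing R] [CommRing S]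
variable {φ : R →+* S} {Ψ : (R × R) ≃+ S} {δ : S} {d : R} (h : IsQuadraticCoordinates φ Ψ δ d)
variable (n : Type*)

/-- a vector with vanishing real and imaginary parts vanishes (`Sⁿ = Rⁿ · 1 ⊕ Rⁿ · δ`). [cite: GelbartRogawski1991, §3.1 p. 454] -/
theorem eq_zero_of_reIm {x : n → S} (h1 : (reIm Ψ n x).1 = 0) (h2 : (reIm Ψ n x).2 = 0) : x = 0 := by
  have : reIm Ψ n x = 0 := Prod.ext h1 h2
  exact (reIm Ψ n).map_eq_zero_iff.1 this

include h

/-- an element of `S` with vanishing real and imaginary parts vanishes (`S = R ⊕ R δ`). [cite: GelbartRogawski1991, §3.1 p. 454] -/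
theorem eq_zero_of_re_im {z : S} (h1 : re Ψ z = 0) (h2 : im Ψ z = 0) : z = 0 := by
  rw [← h.re_add_im z, h1, h2]
  simp only [map_zero, zero_mul, add_zero]

/-- real part of a scalar multiple: `re (e x) = re e · a + (d · im e) · b` for `x = a + bδ` (the block formula of
restriction of scalars, `resAut_apply_mk`). [cite: GelbartRogawski1991, §3.1 p. 454] -/
theorem fst_reIm_smul (e : S) (x : n → S) :
    (reIm Ψ n (e • x)).1 = re Ψ e • (reIm Ψ n x).1 + (d * im Ψ e) • (reIm Ψ n x).2 := by
  funext i
  simp only [reIm_apply_fst, reIm_apply_snd, Pi.smul_apply, Pi.add_apply, smul_eq_mul, h.re_mul]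
  ring

/-- imaginary part of a scalar multiple: `im (e x) = im e · a + re e · b` for `x = a + bδ`. [cite: GelbartRogawski1991, §3.1 p. 454] -/
theorem snd_reIm_smul (e : S) (x : n → S) :
    (reIm Ψ n (e • x)).2 = im Ψ e • (reIm Ψ n x).1 + re Ψ e • (reIm Ψ n x).2 := by
  funext i
  simp only [reIm_apply_fst, reIm_apply_snd, Pi.smul_apply, Pi.add_apply, smul_eq_mul, h.im_mul]
  ring

omit h in
/-- **sesquilinearity**: `h(e x, e' y) = σ(e) e' h(x, y)`. [cite: GelbartRogawski1991, §3.1 p. 454] -/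
theorem hermForm_smul_smul [Fintype n] (σ : S →+* S) (H : Matrix n n S) (e e' : S) (x y : n → S) :
    hermForm σ H (e • x) (e' • y) = σ e * e' * hermForm σ H x y := by
  have h1 : (⇑σ ∘ (e • x)) = σ e • (⇑σ ∘ x) := funext fun i => by simp [Pi.smul_apply, smul_eq_mul, map_mul]
  rw [hermForm, hermForm, h1, mulVec_smul, smul_dotProduct, dotProduct_smul, smul_eq_mul, smul_eq_mul, mul_assoc]

variable [Fintype n] [DecidableEq n]

/-- `re (σ z · (φ t · w)) = t · (re z · re w - d · im z · im w)`: the summand of `re h(x, y)`. [folklore] -/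
private theorem re_conj_mul_map_mul {σ : S →+* S} (hσφ : ∀ a, σ (φ a) = φ a) (hσδ : σ δ = -δ) (z w : S) (t : R) :
    re Ψ (σ z * (φ t * w)) = t * (re Ψ z * re Ψ w - d * (im Ψ z * im Ψ w)) := by
  rw [h.re_mul, h.re_conj hσφ hσδ, h.im_conj hσφ hσδ, h.re_map_mul, h.im_map_mul]
  ring

/-- **`re h(x, y) = aᵀ T a' - d · bᵀ T b'`** for `H = T ⊗ 1`, `x = a + bδ`, `y = a' + b'δ`: the real part of the
hermitian pairing in the polarisation `Rⁿ · 1 ⊕ Rⁿ · δ` (companion of `im_hermForm_map`).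
[cite: GelbartRogawski1991, §3.1 p. 454] -/
theorem re_hermForm_map (T : Matrix n n R) {σ : S →+* S} (hσφ : ∀ a, σ (φ a) = φ a) (hσδ : σ δ = -δ)
    (x y : n → S) :
    re Ψ (hermForm σ (T.map φ) x y) =
      Matrix.toLinearMap₂' R T (reIm Ψ n x).1 (reIm Ψ n y).1 -
        d * Matrix.toLinearMap₂' R T (reIm Ψ n x).2 (reIm Ψ n y).2 := by
  simp only [hermForm, dotProduct, Matrix.mulVec, Function.comp_apply, Matrix.map_apply, Finset.mul_sum, map_sum,
    h.re_conj_mul_map_mul hσφ hσδ, Matrix.toLinearMap₂'_apply', reIm_apply_fst, reIm_apply_snd]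
  rw [← Finset.sum_sub_distrib]
  refine Finset.sum_congr rfl fun i _ => ?_
  rw [← Finset.sum_sub_distrib]
  exact Finset.sum_congr rfl fun j _ => by ring

end CommRing

section Field

variable {R S : Type*} [Field R] [CommRing S]
variable {φ : R →+* S} {Ψ : (R × R) ≃+ S} {δ : S} {d : R} (h : IsQuadraticCoordinates φ Ψ δ d)
variable (n : Type*) [Fintype n] [DecidableEq n]
include h

/-- **an isotropic vector in general position.**  `R` a field with `2` invertible, `T` symmetric with `det T` a unit,
`d` not a square in `R`; if `(Sⁿ, h)` (`H = T ⊗ 1`) has a non-zero isotropic vector, it has an isotropic vector whose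
real and imaginary parts are linearly independent over `R`.  (A real isotropic `a₀` is completed to a hyperbolic pair
`(a₀, c)`, [Serre1973, Ch. IV §1.3 Prop. 3], and `a₀ + cδ` is isotropic: `re h = β(a₀,a₀) - dβ(c,c) = 0`, `im h = 0`.)
[cite: Serre1973, Ch. IV §1.3, Prop. 3] -/
theorem exists_isotropic_linearIndependent [Invertible (2 : R)] {T : Matrix n n R} (hT : T.IsSymm)
    (hTd : IsUnit T.det) (hd : ∀ κ : R, κ * κ ≠ d) {σ : S →+* S} (hσφ : ∀ a, σ (φ a) = φ a) (hσδ : σ δ = -δ)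
    {x₀ : n → S} (hx₀ : x₀ ≠ 0) (hiso : hermForm σ (T.map φ) x₀ x₀ = 0) :
    ∃ x : n → S, hermForm σ (T.map φ) x x = 0 ∧ LinearIndependent R ![(reIm Ψ n x).1, (reIm Ψ n x).2] := by
  by_cases hli : LinearIndependent R ![(reIm Ψ n x₀).1, (reIm Ψ n x₀).2]
  · exact ⟨x₀, hiso, hli⟩
  -- the real part of the isotropy relation: `β(a,a) = d β(b,b)`
  set a := (reIm Ψ n x₀).1 with ha
  set b := (reIm Ψ n x₀).2 with hb
  have hre : a ⬝ᵥ T *ᵥ a - d * (b ⬝ᵥ T *ᵥ b) = 0 := by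
    have := congrArg (re Ψ) hiso
    rw [h.re_hermForm_map n T hσφ hσδ, map_zero, Matrix.toLinearMap₂'_apply', Matrix.toLinearMap₂'_apply'] at this
    exact this
  have hd0 : d ≠ 0 := fun h0 => hd 0 (by rw [mul_zero, h0])
  -- Step 1: a REAL non-zero isotropic vector `a₀`
  obtain ⟨a₀, ha₀0, ha₀⟩ : ∃ a₀ : n → R, a₀ ≠ 0 ∧ a₀ ⬝ᵥ T *ᵥ a₀ = 0 := by
    obtain ⟨s, t, hst, hst0⟩ : ∃ s t : R, s • a + t • b = 0 ∧ ¬(s = 0 ∧ t = 0) := by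
      simpa only [LinearIndependent.pair_iff, not_forall, Classical.not_imp, exists_prop] using hli
    by_cases ht : t = 0
    · -- `s • a = 0` with `s ≠ 0`: `a = 0`, and then `b` is real isotropic
      subst ht
      have hs : s ≠ 0 := fun hs => hst0 ⟨hs, rfl⟩
      rw [zero_smul, add_zero] at hst
      have ha0 : a = 0 := by simpa [hs] using hst
      refine ⟨b, fun hb0 => hx₀ (eq_zero_of_reIm n ha0 hb0), ?_⟩
      rw [ha0, zero_dotProduct, zero_sub, neg_eq_zero, mul_eq_zero] at hre
      exact hre.resolve_left hd0
    · -- `b = κ • a`: then `(1 - d κ²) β(a,a) = 0`, so `a` is real isotropic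
      obtain ⟨κ, hκ⟩ : ∃ κ : R, κ = -(s / t) := ⟨_, rfl⟩
      have hbκ : b = κ • a := by
        have : t • b = -(s • a) := eq_neg_of_add_eq_zero_right hst
        calc b = t⁻¹ • (t • b) := by rw [smul_smul, inv_mul_cancel₀ ht, one_smul]
          _ = κ • a := by rw [this, hκ, smul_neg, smul_smul, neg_smul, div_eq_inv_mul]
      have haa : (1 - d * (κ * κ)) * (a ⬝ᵥ T *ᵥ a) = 0 := by
        rw [hbκ, mulVec_smul, dotProduct_smul, smul_dotProduct, smul_eq_mul, smul_eq_mul] at hre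
        linear_combination hre
      have hcoef : 1 - d * (κ * κ) ≠ 0 := by
        intro h0
        by_cases hκ0 : κ = 0
        · rw [hκ0, mul_zero, mul_zero, sub_zero] at h0; exact one_ne_zero h0
        · apply hd κ⁻¹
          have hk : d * (κ * κ) = 1 := by linear_combination -h0
          field_simp
          linear_combination -hk
      have ha0 : a ≠ 0 := by
        intro ha0
        exact hx₀ (eq_zero_of_reIm n ha0 (by rw [← hb, hbκ, ha0, smul_zero]))
      exact ⟨a, ha0, (mul_eq_zero.1 haa).resolve_left hcoef⟩
  -- Step 2: hyperbolic partner `c`, and `x = a₀ + c δ`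
  obtain ⟨c, ha₀c, hcc⟩ := Literature.LinearAlgebra.exists_hyperbolic_partner hT hTd ha₀0 ha₀
  refine ⟨(reIm Ψ n).symm (a₀, c), ?_, ?_⟩
  · -- isotropic: real part `β(a₀,a₀) - d β(c,c) = 0`, imaginary part `β(a₀,c) - β(a₀,c) = 0`
    refine h.eq_zero_of_re_im ?_ ?_
    · rw [h.re_hermForm_map n T hσφ hσδ, AddEquiv.apply_symm_apply, Matrix.toLinearMap₂'_apply',
        Matrix.toLinearMap₂'_apply', ha₀, hcc, mul_zero, sub_zero]
    · rw [h.im_hermForm_map n hT hσφ hσδ, alt_apply, sub_self]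
  · rw [AddEquiv.apply_symm_apply, LinearIndependent.pair_iff]
    intro s t hst
    dsimp only at hst
    have h1 : a₀ ⬝ᵥ T *ᵥ (s • a₀ + t • c) = 0 := by rw [hst, mulVec_zero, dotProduct_zero]
    rw [mulVec_add, mulVec_smul, mulVec_smul, dotProduct_add, dotProduct_smul, dotProduct_smul, ha₀, ha₀c, smul_zero,
      zero_add, smul_eq_mul, mul_one] at h1
    subst h1
    rw [zero_smul, add_zero, smul_eq_zero] at hst
    exact ⟨hst.resolve_right ha₀0, rfl⟩

/-- **the Lagrangian graph through an isotropic line in general position, and a dual vector.**  For an isotropic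
`x = a + bδ` with `a, b` linearly independent there are a symmetric `S_x ∈ Mₙ(R)` with `T · im(e x) = S_x · re(e x)`
for every `e ∈ S` — the `R`-plane `{reIm (e x)}` lies in the Lagrangian `{(u, w) : T w = S_x u}` of `alt (polar β_T)` —
and `a' ∈ Rⁿ` with `a' · re(e x) = re e` for every `e` (`S_x a = T b`, `S_x b = d⁻¹ T a`, compatible because
`aᵀ T a = d bᵀ T b`; `a'` dual to `a` against `b`). [cite: MoeglinVignerasWaldspurger1987, Chap. 3 §IV.2] -/
theorem exists_isSymm_graph_and_dual {T : Matrix n n R} (hd : ∀ κ : R, κ * κ ≠ d)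
    {σ : S →+* S} (hσφ : ∀ a, σ (φ a) = φ a) (hσδ : σ δ = -δ) {x : n → S} (hiso : hermForm σ (T.map φ) x x = 0)
    (hli : LinearIndependent R ![(reIm Ψ n x).1, (reIm Ψ n x).2]) :
    ∃ (Sx : Matrix n n R) (a' : n → R), Sx.IsSymm ∧
      (∀ e : S, T *ᵥ (reIm Ψ n (e • x)).2 = Sx *ᵥ (reIm Ψ n (e • x)).1) ∧
      (∀ e : S, a' ⬝ᵥ (reIm Ψ n (e • x)).1 = re Ψ e) := by
  set a := (reIm Ψ n x).1 with ha
  set b := (reIm Ψ n x).2 with hb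
  have hd0 : d ≠ 0 := fun h0 => hd 0 (by rw [mul_zero, h0])
  have hre : a ⬝ᵥ T *ᵥ a - d * (b ⬝ᵥ T *ᵥ b) = 0 := by
    have := congrArg (re Ψ) hiso
    rw [h.re_hermForm_map n T hσφ hσδ, map_zero, Matrix.toLinearMap₂'_apply', Matrix.toLinearMap₂'_apply'] at this
    exact this
  have hpq : a ⬝ᵥ (d⁻¹ • (T *ᵥ a)) = b ⬝ᵥ (T *ᵥ b) := by
    rw [dotProduct_smul, smul_eq_mul]
    field_simp
    linear_combination hre
  obtain ⟨Sx, hSx, hSa, hSb⟩ := Literature.LinearAlgebra.exists_isSymm_mulVec_eq_mulVec_eq hli (T *ᵥ b) (d⁻¹ • (T *ᵥ a)) hpq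
  obtain ⟨a', b', ha'a, ha'b, -, -⟩ := Literature.LinearAlgebra.exists_dual_pair hli
  refine ⟨Sx, a', hSx, fun e => ?_, fun e => ?_⟩
  · rw [h.fst_reIm_smul, h.snd_reIm_smul, mulVec_add, mulVec_add, mulVec_smul, mulVec_smul, mulVec_smul, mulVec_smul,
      ← ha, ← hb, hSa, hSb, smul_smul,
      show d * im Ψ e * d⁻¹ = im Ψ e by rw [mul_comm d, mul_assoc, mul_inv_cancel₀ hd0, mul_one], add_comm]
  · rw [h.fst_reIm_smul, ← ha, ← hb, dotProduct_add, dotProduct_smul, dotProduct_smul, ha'a, ha'b, smul_eq_mul,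
      mul_one, smul_zero, add_zero]

end Field

end IsQuadraticCoordinates

end UnitaryGroup

end Literature.NumberTheory.Automorphic
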